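import Mathlib
import Summits.Ventures.HodgeRepro.Tier4.Common.TorusInfCompactConj
import Summits.Ventures.HodgeRepro.Tier4.Common.SettingOfData
import Summits.Ventures.HodgeRepro.Tier4.Line4.ArchWitnessCutoff
import Summits.Ventures.HodgeRepro.Tier4.Line4.ArchMatching
import Summits.Ventures.HodgeRepro.Tier4.Line4.ArchIntegrableOfGrowth
import Summits.Ventures.HodgeRepro.Tier4.Line4.ArchSeesawBridge

/-!
# Tier4/Line4/ArchMatchingCutoff — C-L4-7A-NODEF, the assembly: `IsArchCoeffD` and `D3CoeffData'` for the CUTOFF WITNESS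
`archWitnessR R` with NO definiteness hypothesis off `w₀`, and the `hdef`-FREE (7a) SUPPORT LEMMA at the seesaw instance
`d3CoeffData'_seesawR`

Blind re-derivation cell `pub-hodge-repro`, Tier 4 (README §9–§10), seat t4-L1-p5 (prover, gen 5; C-L4-7A-NODEF S15560,
plan-4's GO S15565 «`hF` is then ∃ R, the `T_∞`-coefficient of `archWitnessR R` at `γ₀` ≠ 0 — say so in the statement»;
module 4 of 4).  Target tree path `lean/Summits/Ventures/HodgeRepro/Tier4/Line4/ArchMatchingCutoff.lean`.  On the seat's
`ArchWitnessCutoff` (module 3), `ArchMatching` (p707463: `chi'_eq_torusWeight'_of_forall_chiMatchesAt'`,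
`toReal_measure_univ_ne_zero_of_isHaarMeasure`), `ArchFactorProd` (p706229: `archFactor_eq_of_mul_torus'`,
`integral_conj_chi'_mul_torusWeight'_eq`), `ArchIntegrableOfGrowth` (p708598: `integrable_of_decay_of_archBallGrowth`),
`ArchWitnessAssembly` (p705769: `a_one_ne_zero_of_pos`), `ArchSeesawBridge` (p708380), `ArchMatchingSeesaw` (p709235's
pattern); L4-p1's `ProdFnIntegrable` (p701176); typer-2's `Common/TorusInfCompactConj`, `Common/SettingOfData`; no printed input.

WHAT IS PROVED (kernel, no print): **`archFactor_archWitnessR(')_ne_zero_of_chiMatchesAt'_haar`** (`arch_ne` from `_hchi'` +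
`[CompactSpace T′_∞]` + Haar + `hF`, through the factorisation `archFactor_eq_of_mul_torus'` with the SAME `torusWeight'`),
**`isArchCoeffD_archWitnessR(')`** (the structure: `cont`/`infOnly`/`equiv`/`decay` by name, `integrable` from `ArchBallGrowth`
through the layer cake, `arch_ne` as above, `pseudo`/`pseudo'` the prints); the branch witness **`archWitnessROf`** with
**`d3CoeffData'_archWitnessROf_of_archBallGrowth`**; **`d3CoeffData'_seesawR`** — the
(7a) support lemma at the seesaw instance in the skeleton's binder shapes (as `d3CoeffData'_seesaw`, p709235) with `hdef`
DELETED: hypotheses = the (7a) binders + `(R) (hR : 0 ≤ R)` + `μ∞` with `ArchBallGrowth` + `hF R` + `hpseudo R` + `hpseudo' R`;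
and **`d3CoeffData'_seesawR_exists`** with the prints packaged as `∃ R, 0 ≤ R ∧ hF R ∧ hpseudo R ∧ hpseudo' R`.
(7a) PRINT CENSUS after this module: `ArchBallGrowth` (shared with (8)) · `∃ R ≥ 0, hF R ∧ hpseudo R ∧ hpseudo' R`; NO `hdef`.
Nothing here says anything about the status of the Hodge conjecture for CM abelian varieties, which is NOT proved
(HC_CM is NOT proved by anyone in this repository).
-/

set_option autoImplicit false

noncomputable section

namespace Summit.Ventures.HodgeRepro.Tier4.Line4

open Summit.Ventures.HodgeRepro.Tier4.Common Summit.Ventures.HodgeRepro.Tier4.Line1 NumberField Matrix MeasureTheory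

open scoped ComplexConjugate

open scoped Classical

section Assembly

variable {k : Type} [Field k] [NumberField k] (q : QuadData k) (a : Fin 4 → k)
  (g g' : Matrix (Fin 4) (Fin 4) k) (hgg' : g * g' = 1) (hg'g : g' * g = 1)
  (hgΩ : g * (PlaneData.mixedRow q (a 0) (a 2)).Ω = (PlaneData.mixedRow q (a 0) (a 2)).Ω * g)
  (lam : k) (hlam : lam ≠ 0)
  (hiso : g * (PlaneData.mixedRow q (a 1) (a 3)).B * gᵀ = lam • (PlaneData.mixedRow q (a 0) (a 2)).B)
  [MeasurableSpace (GA ((PlaneData.mixedRow q (a 0) (a 2)).withTransportedTorus g g' hgg' hg'g hgΩ))]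
  [BorelSpace (GA ((PlaneData.mixedRow q (a 0) (a 2)).withTransportedTorus g g' hgg' hg'g hgΩ))]
  (S : RTF.Setting (GA ((PlaneData.mixedRow q (a 0) (a 2)).withTransportedTorus g g' hgg' hg'g hgΩ)))
  (R : RTFData ((PlaneData.mixedRow q (a 0) (a 2)).withTransportedTorus g g' hgg' hg'g hgΩ))
  (w₀ : InfinitePlace k) (eP eM eP' eM' : InfinitePlace k → ℤ) (Rc : ℝ)
  (γ₀ : GA ((PlaneData.mixedRow q (a 0) (a 2)).withTransportedTorus g g' hgg' hg'g hgΩ))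
  (νinf : Measure (torusInf ((PlaneData.mixedRow q (a 0) (a 2)).withTransportedTorus g g' hgg' hg'g hgΩ)))
  (νinf' : Measure (torusInf' ((PlaneData.mixedRow q (a 0) (a 2)).withTransportedTorus g g' hgg' hg'g hgΩ)))

include hlam in
omit [BorelSpace (GA ((PlaneData.mixedRow q (a 0) (a 2)).withTransportedTorus g g' hgg' hg'g hgΩ))] in
/-- **`arch_ne` for `archWitnessR`** from `_hchi'`, `T′_∞` compact, `ν′` Haar and the Fourier clause `hF`. -/
theorem archFactor_archWitnessR_ne_zero_of_chiMatchesAt'_haar (hall : ∀ w : InfinitePlace k, w.IsReal ∧ IsCMAt q w)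
    (ha1 : a 1 ≠ 0) (ha3 : a 3 ≠ 0) (he : eP' w₀ = eM' w₀ + 3)
    (hchi' : ∀ w : InfinitePlace k, ChiMatchesAt' ((PlaneData.mixedRow q (a 0) (a 2)).withTransportedTorus g g' hgg' hg'g hgΩ)
      q w g g' (eP' w) (eM' w) R.chi')
    [CompactSpace (torusInf' ((PlaneData.mixedRow q (a 0) (a 2)).withTransportedTorus g g' hgg' hg'g hgΩ))]
    [νinf'.IsHaarMeasure]
    (hF : (∫ t : torusInf ((PlaneData.mixedRow q (a 0) (a 2)).withTransportedTorus g g' hgg' hg'g hgΩ),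
        R.chi t * archWitnessR q a g g' hgg' hg'g hgΩ lam hiso w₀ eP' eM' Rc
          (((t : torusT ((PlaneData.mixedRow q (a 0) (a 2)).withTransportedTorus g g' hgg' hg'g hgΩ)) :
            GA ((PlaneData.mixedRow q (a 0) (a 2)).withTransportedTorus g g' hgg' hg'g hgΩ))⁻¹ * γ₀) ∂νinf) ≠ 0) :
    L1Class.archFactor ((PlaneData.mixedRow q (a 0) (a 2)).withTransportedTorus g g' hgg' hg'g hgΩ) R
      (archWitnessR q a g g' hgg' hg'g hgΩ lam hiso w₀ eP' eM' Rc) γ₀ νinf νinf' ≠ 0 := by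
  rw [archFactor_eq_of_mul_torus' q a g g' hgg' hg'g hgΩ R γ₀ νinf νinf' _ _
      (fun x κ hκ => archWitnessR_mul_torus' q a g g' hgg' hg'g hgΩ lam hlam hiso w₀ eP' eM' Rc hall ha1 ha3 he x κ hκ),
    integral_conj_chi'_mul_torusWeight'_eq q a g g' hgg' hg'g hgΩ lam hlam hiso R eP' eM' νinf' hall ha1 ha3
      (chi'_eq_torusWeight'_of_forall_chiMatchesAt' q a g g' hgg' hg'g hgΩ lam hlam hiso R eP' eM' hall ha1 ha3 hchi')]
  exact mul_ne_zero (by exact_mod_cast toReal_measure_univ_ne_zero_of_isHaarMeasure νinf') hF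

include hlam in
omit [BorelSpace (GA ((PlaneData.mixedRow q (a 0) (a 2)).withTransportedTorus g g' hgg' hg'g hgΩ))] in
/-- **`arch_ne` for `archWitnessR'`**. -/
theorem archFactor_archWitnessR'_ne_zero_of_chiMatchesAt'_haar (hall : ∀ w : InfinitePlace k, w.IsReal ∧ IsCMAt q w)
    (ha1 : a 1 ≠ 0) (ha3 : a 3 ≠ 0) (he : eM' w₀ = eP' w₀ + 3)
    (hchi' : ∀ w : InfinitePlace k, ChiMatchesAt' ((PlaneData.mixedRow q (a 0) (a 2)).withTransportedTorus g g' hgg' hg'g hgΩ)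
      q w g g' (eP' w) (eM' w) R.chi')
    [CompactSpace (torusInf' ((PlaneData.mixedRow q (a 0) (a 2)).withTransportedTorus g g' hgg' hg'g hgΩ))]
    [νinf'.IsHaarMeasure]
    (hF : (∫ t : torusInf ((PlaneData.mixedRow q (a 0) (a 2)).withTransportedTorus g g' hgg' hg'g hgΩ),
        R.chi t * archWitnessR' q a g g' hgg' hg'g hgΩ lam hiso w₀ eP' eM' Rc
          (((t : torusT ((PlaneData.mixedRow q (a 0) (a 2)).withTransportedTorus g g' hgg' hg'g hgΩ)) :
            GA ((PlaneData.mixedRow q (a 0) (a 2)).withTransportedTorus g g' hgg' hg'g hgΩ))⁻¹ * γ₀) ∂νinf) ≠ 0) :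
    L1Class.archFactor ((PlaneData.mixedRow q (a 0) (a 2)).withTransportedTorus g g' hgg' hg'g hgΩ) R
      (archWitnessR' q a g g' hgg' hg'g hgΩ lam hiso w₀ eP' eM' Rc) γ₀ νinf νinf' ≠ 0 := by
  rw [archFactor_eq_of_mul_torus' q a g g' hgg' hg'g hgΩ R γ₀ νinf νinf' _ _
      (fun x κ hκ => archWitnessR'_mul_torus' q a g g' hgg' hg'g hgΩ lam hlam hiso w₀ eP' eM' Rc hall ha1 ha3 he x κ hκ),
    integral_conj_chi'_mul_torusWeight'_eq q a g g' hgg' hg'g hgΩ lam hlam hiso R eP' eM' νinf' hall ha1 ha3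
      (chi'_eq_torusWeight'_of_forall_chiMatchesAt' q a g g' hgg' hg'g hgΩ lam hlam hiso R eP' eM' hall ha1 ha3 hchi')]
  exact mul_ne_zero (by exact_mod_cast toReal_measure_univ_ne_zero_of_isHaarMeasure νinf') hF

include hlam in
/-- **`IsArchCoeffD` for `archWitnessR`** — no definiteness off `w₀`: every infinite place real CM, the `U(1,1)` signs at
`w₀`, `0 ≤ R`, the display's `_hchi'`, `T′_∞` compact with Haar `ν′`, `μ∞` Haar with `ArchBallGrowth`, and the two prints
`hF`, `hpseudo`/`hpseudo'` (holomorphic branch `eP′ w₀ = eM′ w₀ + 3`). -/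
theorem isArchCoeffD_archWitnessR [S.μ.IsHaarMeasure]
    (μinf : Measure (infinitePart ((PlaneData.mixedRow q (a 0) (a 2)).withTransportedTorus g g' hgg' hg'g hgΩ)))
    [μinf.IsHaarMeasure]
    (hgrowth : ArchBallGrowth ((PlaneData.mixedRow q (a 0) (a 2)).withTransportedTorus g g' hgg' hg'g hgΩ) μinf)
    [CompactSpace (torusInf' ((PlaneData.mixedRow q (a 0) (a 2)).withTransportedTorus g g' hgg' hg'g hgΩ))]
    [νinf'.IsHaarMeasure]
    (hall : ∀ w : InfinitePlace k, w.IsReal ∧ IsCMAt q w)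
    (ha1 : 0 < (adToC w₀ (algebraMap k (Ad k) (a 1))).re) (ha3 : (adToC w₀ (algebraMap k (Ad k) (-1 * a 3))).re < 0)
    (hR : 0 ≤ Rc) (he : eP' w₀ = eM' w₀ + 3)
    (hchi' : ∀ w : InfinitePlace k, ChiMatchesAt' ((PlaneData.mixedRow q (a 0) (a 2)).withTransportedTorus g g' hgg' hg'g hgΩ)
      q w g g' (eP' w) (eM' w) R.chi')
    (hF : (∫ t : torusInf ((PlaneData.mixedRow q (a 0) (a 2)).withTransportedTorus g g' hgg' hg'g hgΩ),
        R.chi t * archWitnessR q a g g' hgg' hg'g hgΩ lam hiso w₀ eP' eM' Rc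
          (((t : torusT ((PlaneData.mixedRow q (a 0) (a 2)).withTransportedTorus g g' hgg' hg'g hgΩ)) :
            GA ((PlaneData.mixedRow q (a 0) (a 2)).withTransportedTorus g g' hgg' hg'g hgΩ))⁻¹ * γ₀) ∂νinf) ≠ 0)
    (hpseudo : ∀ ffin : GA ((PlaneData.mixedRow q (a 0) (a 2)).withTransportedTorus g g' hgg' hg'g hgΩ) → ℂ,
      L1Class.IsFinFactor ((PlaneData.mixedRow q (a 0) (a 2)).withTransportedTorus g g' hgg' hg'g hgΩ) ffin →
      IsPseudoCoeffAt ((PlaneData.mixedRow q (a 0) (a 2)).withTransportedTorus g g' hgg' hg'g hgΩ) S q w₀ eP eM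
        (RTF.cj (L1Class.prodFn ((PlaneData.mixedRow q (a 0) (a 2)).withTransportedTorus g g' hgg' hg'g hgΩ)
          (archWitnessR q a g g' hgg' hg'g hgΩ lam hiso w₀ eP' eM' Rc) ffin)))
    (hpseudo' : ∀ ffin : GA ((PlaneData.mixedRow q (a 0) (a 2)).withTransportedTorus g g' hgg' hg'g hgΩ) → ℂ,
      L1Class.IsFinFactor ((PlaneData.mixedRow q (a 0) (a 2)).withTransportedTorus g g' hgg' hg'g hgΩ) ffin →
      IsPseudoCoeffAt' ((PlaneData.mixedRow q (a 0) (a 2)).withTransportedTorus g g' hgg' hg'g hgΩ) S q g g' w₀ eP' eM'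
        (RTF.cj (L1Class.prodFn ((PlaneData.mixedRow q (a 0) (a 2)).withTransportedTorus g g' hgg' hg'g hgΩ)
          (archWitnessR q a g g' hgg' hg'g hgΩ lam hiso w₀ eP' eM' Rc) ffin))) :
    L1Class.IsArchCoeffD ((PlaneData.mixedRow q (a 0) (a 2)).withTransportedTorus g g' hgg' hg'g hgΩ) S R q g g' w₀
      eP eM eP' eM' γ₀ νinf νinf' (archWitnessR q a g g' hgg' hg'g hgΩ lam hiso w₀ eP' eM' Rc) where
  cont := continuous_archWitnessR q a g g' hgg' hg'g hgΩ lam hiso w₀ eP' eM' Rc (hall w₀).1 (hall w₀).2 ha1 ha3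
  infOnly := archWitnessR_ofInfPart q a g g' hgg' hg'g hgΩ lam hiso w₀ eP' eM' Rc
  arch_ne := archFactor_archWitnessR_ne_zero_of_chiMatchesAt'_haar q a g g' hgg' hg'g hgΩ lam hlam hiso R w₀ eP' eM' Rc γ₀
    νinf νinf' hall (a_one_ne_zero_of_pos a w₀ ha1) (a_three_ne_zero_of_neg a w₀ ha3) he hchi' hF
  equiv := cj_archWitnessR_inv_mul q a g g' hgg' hg'g hgΩ lam hlam hiso w₀ eP' eM' Rc hall (a_one_ne_zero_of_pos a w₀ ha1)
    (a_three_ne_zero_of_neg a w₀ ha3) he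
  integrable := fun _ hffin => integrable_prodFn_of_isFinFactor _ S.μ μinf
    (integrable_of_decay_of_archBallGrowth _ μinf hgrowth
      (continuous_archWitnessR q a g g' hgg' hg'g hgΩ lam hiso w₀ eP' eM' Rc (hall w₀).1 (hall w₀).2 ha1 ha3)
      (decay_archWitnessR q a g g' hgg' hg'g hgΩ lam hlam hiso w₀ eP' eM' Rc hall ha1 ha3 hR)) hffin
  pseudo := hpseudo
  pseudo' := hpseudo'
  decay := decay_archWitnessR q a g g' hgg' hg'g hgΩ lam hlam hiso w₀ eP' eM' Rc hall ha1 ha3 hR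

include hlam in
/-- **`IsArchCoeffD` for `archWitnessR'`** (antiholomorphic branch `eM′ w₀ = eP′ w₀ + 3`). -/
theorem isArchCoeffD_archWitnessR' [S.μ.IsHaarMeasure]
    (μinf : Measure (infinitePart ((PlaneData.mixedRow q (a 0) (a 2)).withTransportedTorus g g' hgg' hg'g hgΩ)))
    [μinf.IsHaarMeasure]
    (hgrowth : ArchBallGrowth ((PlaneData.mixedRow q (a 0) (a 2)).withTransportedTorus g g' hgg' hg'g hgΩ) μinf)
    [CompactSpace (torusInf' ((PlaneData.mixedRow q (a 0) (a 2)).withTransportedTorus g g' hgg' hg'g hgΩ))]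
    [νinf'.IsHaarMeasure]
    (hall : ∀ w : InfinitePlace k, w.IsReal ∧ IsCMAt q w)
    (ha1 : 0 < (adToC w₀ (algebraMap k (Ad k) (a 1))).re) (ha3 : (adToC w₀ (algebraMap k (Ad k) (-1 * a 3))).re < 0)
    (hR : 0 ≤ Rc) (he : eM' w₀ = eP' w₀ + 3)
    (hchi' : ∀ w : InfinitePlace k, ChiMatchesAt' ((PlaneData.mixedRow q (a 0) (a 2)).withTransportedTorus g g' hgg' hg'g hgΩ)
      q w g g' (eP' w) (eM' w) R.chi')
    (hF : (∫ t : torusInf ((PlaneData.mixedRow q (a 0) (a 2)).withTransportedTorus g g' hgg' hg'g hgΩ),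
        R.chi t * archWitnessR' q a g g' hgg' hg'g hgΩ lam hiso w₀ eP' eM' Rc
          (((t : torusT ((PlaneData.mixedRow q (a 0) (a 2)).withTransportedTorus g g' hgg' hg'g hgΩ)) :
            GA ((PlaneData.mixedRow q (a 0) (a 2)).withTransportedTorus g g' hgg' hg'g hgΩ))⁻¹ * γ₀) ∂νinf) ≠ 0)
    (hpseudo : ∀ ffin : GA ((PlaneData.mixedRow q (a 0) (a 2)).withTransportedTorus g g' hgg' hg'g hgΩ) → ℂ,
      L1Class.IsFinFactor ((PlaneData.mixedRow q (a 0) (a 2)).withTransportedTorus g g' hgg' hg'g hgΩ) ffin →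
      IsPseudoCoeffAt ((PlaneData.mixedRow q (a 0) (a 2)).withTransportedTorus g g' hgg' hg'g hgΩ) S q w₀ eP eM
        (RTF.cj (L1Class.prodFn ((PlaneData.mixedRow q (a 0) (a 2)).withTransportedTorus g g' hgg' hg'g hgΩ)
          (archWitnessR' q a g g' hgg' hg'g hgΩ lam hiso w₀ eP' eM' Rc) ffin)))
    (hpseudo' : ∀ ffin : GA ((PlaneData.mixedRow q (a 0) (a 2)).withTransportedTorus g g' hgg' hg'g hgΩ) → ℂ,
      L1Class.IsFinFactor ((PlaneData.mixedRow q (a 0) (a 2)).withTransportedTorus g g' hgg' hg'g hgΩ) ffin →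
      IsPseudoCoeffAt' ((PlaneData.mixedRow q (a 0) (a 2)).withTransportedTorus g g' hgg' hg'g hgΩ) S q g g' w₀ eP' eM'
        (RTF.cj (L1Class.prodFn ((PlaneData.mixedRow q (a 0) (a 2)).withTransportedTorus g g' hgg' hg'g hgΩ)
          (archWitnessR' q a g g' hgg' hg'g hgΩ lam hiso w₀ eP' eM' Rc) ffin))) :
    L1Class.IsArchCoeffD ((PlaneData.mixedRow q (a 0) (a 2)).withTransportedTorus g g' hgg' hg'g hgΩ) S R q g g' w₀
      eP eM eP' eM' γ₀ νinf νinf' (archWitnessR' q a g g' hgg' hg'g hgΩ lam hiso w₀ eP' eM' Rc) where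
  cont := continuous_archWitnessR' q a g g' hgg' hg'g hgΩ lam hiso w₀ eP' eM' Rc (hall w₀).1 (hall w₀).2 ha1 ha3
  infOnly := archWitnessR'_ofInfPart q a g g' hgg' hg'g hgΩ lam hiso w₀ eP' eM' Rc
  arch_ne := archFactor_archWitnessR'_ne_zero_of_chiMatchesAt'_haar q a g g' hgg' hg'g hgΩ lam hlam hiso R w₀ eP' eM' Rc γ₀
    νinf νinf' hall (a_one_ne_zero_of_pos a w₀ ha1) (a_three_ne_zero_of_neg a w₀ ha3) he hchi' hF
  equiv := cj_archWitnessR'_inv_mul q a g g' hgg' hg'g hgΩ lam hlam hiso w₀ eP' eM' Rc hall (a_one_ne_zero_of_pos a w₀ ha1)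
    (a_three_ne_zero_of_neg a w₀ ha3) he
  integrable := fun _ hffin => integrable_prodFn_of_isFinFactor _ S.μ μinf
    (integrable_of_decay_of_archBallGrowth _ μinf hgrowth
      (continuous_archWitnessR' q a g g' hgg' hg'g hgΩ lam hiso w₀ eP' eM' Rc (hall w₀).1 (hall w₀).2 ha1 ha3)
      (decay_archWitnessR' q a g g' hgg' hg'g hgΩ lam hlam hiso w₀ eP' eM' Rc hall ha1 ha3 hR)) hffin
  pseudo := hpseudo
  pseudo' := hpseudo'
  decay := decay_archWitnessR' q a g g' hgg' hg'g hgΩ lam hlam hiso w₀ eP' eM' Rc hall ha1 ha3 hR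

/-- **the branch cutoff witness**: `archWitnessR` when `eP′ w₀ = eM′ w₀ + 3`, `archWitnessR'` otherwise. -/
def archWitnessROf : GA ((PlaneData.mixedRow q (a 0) (a 2)).withTransportedTorus g g' hgg' hg'g hgΩ) → ℂ :=
  if eP' w₀ = eM' w₀ + 3 then archWitnessR q a g g' hgg' hg'g hgΩ lam hiso w₀ eP' eM' Rc
  else archWitnessR' q a g g' hgg' hg'g hgΩ lam hiso w₀ eP' eM' Rc

include hlam in
/-- **`D3CoeffData'` for the branch cutoff witness** — NO definiteness off `w₀`. -/
theorem d3CoeffData'_archWitnessROf_of_archBallGrowth [S.μ.IsHaarMeasure]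
    (μinf : Measure (infinitePart ((PlaneData.mixedRow q (a 0) (a 2)).withTransportedTorus g g' hgg' hg'g hgΩ)))
    [μinf.IsHaarMeasure]
    (hgrowth : ArchBallGrowth ((PlaneData.mixedRow q (a 0) (a 2)).withTransportedTorus g g' hgg' hg'g hgΩ) μinf)
    [CompactSpace (torusInf' ((PlaneData.mixedRow q (a 0) (a 2)).withTransportedTorus g g' hgg' hg'g hgΩ))]
    [νinf'.IsHaarMeasure]
    (hall : ∀ w : InfinitePlace k, w.IsReal ∧ IsCMAt q w)
    (ha1 : 0 < (adToC w₀ (algebraMap k (Ad k) (a 1))).re) (ha3 : (adToC w₀ (algebraMap k (Ad k) (-1 * a 3))).re < 0)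
    (hR : 0 ≤ Rc) (he : eP' w₀ = eM' w₀ + 3 ∨ eM' w₀ = eP' w₀ + 3)
    (hchi' : ∀ w : InfinitePlace k, ChiMatchesAt' ((PlaneData.mixedRow q (a 0) (a 2)).withTransportedTorus g g' hgg' hg'g hgΩ)
      q w g g' (eP' w) (eM' w) R.chi')
    (hF : (∫ t : torusInf ((PlaneData.mixedRow q (a 0) (a 2)).withTransportedTorus g g' hgg' hg'g hgΩ),
        R.chi t * archWitnessROf q a g g' hgg' hg'g hgΩ lam hiso w₀ eP' eM' Rc
          (((t : torusT ((PlaneData.mixedRow q (a 0) (a 2)).withTransportedTorus g g' hgg' hg'g hgΩ)) :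
            GA ((PlaneData.mixedRow q (a 0) (a 2)).withTransportedTorus g g' hgg' hg'g hgΩ))⁻¹ * γ₀) ∂νinf) ≠ 0)
    (hpseudo : ∀ ffin : GA ((PlaneData.mixedRow q (a 0) (a 2)).withTransportedTorus g g' hgg' hg'g hgΩ) → ℂ,
      L1Class.IsFinFactor ((PlaneData.mixedRow q (a 0) (a 2)).withTransportedTorus g g' hgg' hg'g hgΩ) ffin →
      IsPseudoCoeffAt ((PlaneData.mixedRow q (a 0) (a 2)).withTransportedTorus g g' hgg' hg'g hgΩ) S q w₀ eP eM
        (RTF.cj (L1Class.prodFn ((PlaneData.mixedRow q (a 0) (a 2)).withTransportedTorus g g' hgg' hg'g hgΩ)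
          (archWitnessROf q a g g' hgg' hg'g hgΩ lam hiso w₀ eP' eM' Rc) ffin)))
    (hpseudo' : ∀ ffin : GA ((PlaneData.mixedRow q (a 0) (a 2)).withTransportedTorus g g' hgg' hg'g hgΩ) → ℂ,
      L1Class.IsFinFactor ((PlaneData.mixedRow q (a 0) (a 2)).withTransportedTorus g g' hgg' hg'g hgΩ) ffin →
      IsPseudoCoeffAt' ((PlaneData.mixedRow q (a 0) (a 2)).withTransportedTorus g g' hgg' hg'g hgΩ) S q g g' w₀ eP' eM'
        (RTF.cj (L1Class.prodFn ((PlaneData.mixedRow q (a 0) (a 2)).withTransportedTorus g g' hgg' hg'g hgΩ)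
          (archWitnessROf q a g g' hgg' hg'g hgΩ lam hiso w₀ eP' eM' Rc) ffin))) :
    L1Class.D3CoeffData' ((PlaneData.mixedRow q (a 0) (a 2)).withTransportedTorus g g' hgg' hg'g hgΩ) S R q g g' w₀
      eP eM eP' eM' γ₀ νinf νinf' := by
  by_cases h : eP' w₀ = eM' w₀ + 3
  · have hdef : archWitnessROf q a g g' hgg' hg'g hgΩ lam hiso w₀ eP' eM' Rc =
        archWitnessR q a g g' hgg' hg'g hgΩ lam hiso w₀ eP' eM' Rc := if_pos h
    rw [hdef] at hF hpseudo hpseudo'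
    exact ⟨_, isArchCoeffD_archWitnessR q a g g' hgg' hg'g hgΩ lam hlam hiso S R w₀ eP eM eP' eM' Rc γ₀ νinf νinf' μinf
      hgrowth hall ha1 ha3 hR h hchi' hF hpseudo hpseudo'⟩
  · have h' : eM' w₀ = eP' w₀ + 3 := he.resolve_left h
    have hdef : archWitnessROf q a g g' hgg' hg'g hgΩ lam hiso w₀ eP' eM' Rc =
        archWitnessR' q a g g' hgg' hg'g hgΩ lam hiso w₀ eP' eM' Rc := if_neg h
    rw [hdef] at hF hpseudo hpseudo'
    exact ⟨_, isArchCoeffD_archWitnessR' q a g g' hgg' hg'g hgΩ lam hlam hiso S R w₀ eP eM eP' eM' Rc γ₀ νinf νinf' μinf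
      hgrowth hall ha1 ha3 hR h' hchi' hF hpseudo hpseudo'⟩

end Assembly

section Seesaw

variable {E : Type} [Field E] [NumberField E]

/-- **THE `hdef`-FREE (7a) SUPPORT LEMMA AT THE SEESAW INSTANCE**: exactly `d3CoeffData'_seesaw` (p709235) with the
definiteness hypothesis `hdef` DELETED and the witness `archWitnessROf Rc` for a displayed cutoff radius `0 ≤ Rc`; the
prints `hF`, `hpseudo`, `hpseudo'` are read at that witness (the display's clause: `∃ Rc ≥ 0, …`, packaged below). -/
theorem d3CoeffData'_seesawR (q : QuadData ↥(maximalRealSubfield E)) (a : Fin 4 → ↥(maximalRealSubfield E))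
    (_ha : ∀ i, a i ≠ 0) (φ : ↥(maximalRealSubfield E) →+* ℂ) (_hpos : ∀ i, 0 < (φ (a i)).re)
    (g g' : Matrix (Fin 4) (Fin 4) ↥(maximalRealSubfield E)) (hgg' : g * g' = 1) (hg'g : g' * g = 1)
    (hgΩ : g * (PlaneData.mixedRow q (a 0) (a 2)).Ω = (PlaneData.mixedRow q (a 0) (a 2)).Ω * g)
    (lam : ↥(maximalRealSubfield E)) (_hlam : lam ≠ 0)
    (_hiso : g * (PlaneData.mixedRow q (a 1) (a 3)).B * gᵀ = lam • (PlaneData.mixedRow q (a 0) (a 2)).B)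
    [MeasurableSpace (GA ((PlaneData.mixedRow q (a 0) (a 2)).withTransportedTorus g g' hgg' hg'g hgΩ))]
    [BorelSpace (GA ((PlaneData.mixedRow q (a 0) (a 2)).withTransportedTorus g g' hgg' hg'g hgΩ))]
    (R : RTFData ((PlaneData.mixedRow q (a 0) (a 2)).withTransportedTorus g g' hgg' hg'g hgΩ))
    [R.μT.IsHaarMeasure] [R.μT'.IsHaarMeasure]
    (eP eM eP' eM' : InfinitePlace ↥(maximalRealSubfield E) → ℤ)
    (_he : eP (InfinitePlace.mk φ) - eM (InfinitePlace.mk φ) = 3 ∨ eP (InfinitePlace.mk φ) - eM (InfinitePlace.mk φ) = -3)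
    (_he' : (0 < (φ lam).re → eP' (InfinitePlace.mk φ) - eM' (InfinitePlace.mk φ) =
        eP (InfinitePlace.mk φ) - eM (InfinitePlace.mk φ)) ∧
      ((φ lam).re < 0 → eP' (InfinitePlace.mk φ) - eM' (InfinitePlace.mk φ) =
        -(eP (InfinitePlace.mk φ) - eM (InfinitePlace.mk φ))))
    (_hchi' : ∀ w : InfinitePlace ↥(maximalRealSubfield E),
      ChiMatchesAt' ((PlaneData.mixedRow q (a 0) (a 2)).withTransportedTorus g g' hgg' hg'g hgΩ) q w g g' (eP' w) (eM' w)
        R.chi')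
    (μ : Measure (GA ((PlaneData.mixedRow q (a 0) (a 2)).withTransportedTorus g g' hgg' hg'g hgΩ))) [μ.IsHaarMeasure]
    (DG : Set (GA ((PlaneData.mixedRow q (a 0) (a 2)).withTransportedTorus g g' hgg' hg'g hgΩ)))
    (fdG : IsFundamentalDomain (rationalPoints ((PlaneData.mixedRow q (a 0) (a 2)).withTransportedTorus g g' hgg' hg'g hgΩ))
      DG μ)
    (compG : IsCompact (closure DG)) (compT : IsCompact (closure R.DT)) (compT' : IsCompact (closure R.DT'))
    (hcm : ∀ w : InfinitePlace ↥(maximalRealSubfield E), IsCMAt q w)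
    (γ₀ : GA ((PlaneData.mixedRow q (a 0) (a 2)).withTransportedTorus g g' hgg' hg'g hgΩ))
    (νinf : Measure (torusInf ((PlaneData.mixedRow q (a 0) (a 2)).withTransportedTorus g g' hgg' hg'g hgΩ)))
    (νinf' : Measure (torusInf' ((PlaneData.mixedRow q (a 0) (a 2)).withTransportedTorus g g' hgg' hg'g hgΩ)))
    [νinf'.IsHaarMeasure]
    (μinf : Measure (infinitePart ((PlaneData.mixedRow q (a 0) (a 2)).withTransportedTorus g g' hgg' hg'g hgΩ)))
    [μinf.IsHaarMeasure]
    (hgrowth : ArchBallGrowth ((PlaneData.mixedRow q (a 0) (a 2)).withTransportedTorus g g' hgg' hg'g hgΩ) μinf)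
    (Rc : ℝ) (hRc : 0 ≤ Rc)
    (hF : (∫ t : torusInf ((PlaneData.mixedRow q (a 0) (a 2)).withTransportedTorus g g' hgg' hg'g hgΩ),
        R.chi t * archWitnessROf q a g g' hgg' hg'g hgΩ lam _hiso (InfinitePlace.mk φ) eP' eM' Rc
          (((t : torusT ((PlaneData.mixedRow q (a 0) (a 2)).withTransportedTorus g g' hgg' hg'g hgΩ)) :
            GA ((PlaneData.mixedRow q (a 0) (a 2)).withTransportedTorus g g' hgg' hg'g hgΩ))⁻¹ * γ₀) ∂νinf) ≠ 0)
    (hpseudo : ∀ ffin : GA ((PlaneData.mixedRow q (a 0) (a 2)).withTransportedTorus g g' hgg' hg'g hgΩ) → ℂ,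
      L1Class.IsFinFactor ((PlaneData.mixedRow q (a 0) (a 2)).withTransportedTorus g g' hgg' hg'g hgΩ) ffin →
      IsPseudoCoeffAt ((PlaneData.mixedRow q (a 0) (a 2)).withTransportedTorus g g' hgg' hg'g hgΩ)
        (Setting.ofAdelicData ((PlaneData.mixedRow q (a 0) (a 2)).withTransportedTorus g g' hgg' hg'g hgΩ) R μ DG fdG
          compG compT compT') q (InfinitePlace.mk φ) eP eM
        (RTF.cj (L1Class.prodFn ((PlaneData.mixedRow q (a 0) (a 2)).withTransportedTorus g g' hgg' hg'g hgΩ)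
          (archWitnessROf q a g g' hgg' hg'g hgΩ lam _hiso (InfinitePlace.mk φ) eP' eM' Rc) ffin)))
    (hpseudo' : ∀ ffin : GA ((PlaneData.mixedRow q (a 0) (a 2)).withTransportedTorus g g' hgg' hg'g hgΩ) → ℂ,
      L1Class.IsFinFactor ((PlaneData.mixedRow q (a 0) (a 2)).withTransportedTorus g g' hgg' hg'g hgΩ) ffin →
      IsPseudoCoeffAt' ((PlaneData.mixedRow q (a 0) (a 2)).withTransportedTorus g g' hgg' hg'g hgΩ)
        (Setting.ofAdelicData ((PlaneData.mixedRow q (a 0) (a 2)).withTransportedTorus g g' hgg' hg'g hgΩ) R μ DG fdG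
          compG compT compT') q g g' (InfinitePlace.mk φ) eP' eM'
        (RTF.cj (L1Class.prodFn ((PlaneData.mixedRow q (a 0) (a 2)).withTransportedTorus g g' hgg' hg'g hgΩ)
          (archWitnessROf q a g g' hgg' hg'g hgΩ lam _hiso (InfinitePlace.mk φ) eP' eM' Rc) ffin))) :
    L1Class.D3CoeffData' ((PlaneData.mixedRow q (a 0) (a 2)).withTransportedTorus g g' hgg' hg'g hgΩ)
      (Setting.ofAdelicData ((PlaneData.mixedRow q (a 0) (a 2)).withTransportedTorus g g' hgg' hg'g hgΩ) R μ DG fdG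
        compG compT compT') R q g g' (InfinitePlace.mk φ) eP eM eP' eM' γ₀ νinf νinf' := by
  have hreal : ∀ w : InfinitePlace ↥(maximalRealSubfield E), w.IsReal := fun w => IsTotallyReal.isReal w
  have hφ : ComplexEmbedding.IsReal φ := InfinitePlace.isReal_mk_iff.1 (hreal (InfinitePlace.mk φ))
  have hall : ∀ w : InfinitePlace ↥(maximalRealSubfield E), w.IsReal ∧ IsCMAt q w := fun w => ⟨hreal w, hcm w⟩
  haveI : CompactSpace (torusInf' ((PlaneData.mixedRow q (a 0) (a 2)).withTransportedTorus g g' hgg' hg'g hgΩ)) :=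
    compactSpace_infinitePart_subgroupOf_torusT'_seesaw q a g g' hgg' hg'g hgΩ lam _hlam _hiso (_ha 1) (_ha 3) hreal hcm
  haveI : (Setting.ofAdelicData ((PlaneData.mixedRow q (a 0) (a 2)).withTransportedTorus g g' hgg' hg'g hgΩ) R μ DG fdG
      compG compT compT').μ.IsHaarMeasure := inferInstanceAs (μ.IsHaarMeasure)
  exact d3CoeffData'_archWitnessROf_of_archBallGrowth q a g g' hgg' hg'g hgΩ lam _hlam _hiso _ R (InfinitePlace.mk φ) eP eM
    eP' eM' Rc γ₀ νinf νinf' μinf hgrowth hall (ha1_of_pos φ hφ a _hpos) (ha3_of_pos φ hφ a _hpos) hRc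
    (he_of_he' (re_ne_zero_of_isReal φ hφ _hlam) _he _he') _hchi' hF hpseudo hpseudo'

/-- **the `∃ Rc` form of `d3CoeffData'_seesawR`** — the prints packaged as ONE displayed clause
`∃ Rc, 0 ≤ Rc ∧ hF Rc ∧ hpseudo Rc ∧ hpseudo' Rc` (plan-4 S15565). -/
theorem d3CoeffData'_seesawR_exists (q : QuadData ↥(maximalRealSubfield E)) (a : Fin 4 → ↥(maximalRealSubfield E))
    (_ha : ∀ i, a i ≠ 0) (φ : ↥(maximalRealSubfield E) →+* ℂ) (_hpos : ∀ i, 0 < (φ (a i)).re)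
    (g g' : Matrix (Fin 4) (Fin 4) ↥(maximalRealSubfield E)) (hgg' : g * g' = 1) (hg'g : g' * g = 1)
    (hgΩ : g * (PlaneData.mixedRow q (a 0) (a 2)).Ω = (PlaneData.mixedRow q (a 0) (a 2)).Ω * g)
    (lam : ↥(maximalRealSubfield E)) (_hlam : lam ≠ 0)
    (_hiso : g * (PlaneData.mixedRow q (a 1) (a 3)).B * gᵀ = lam • (PlaneData.mixedRow q (a 0) (a 2)).B)
    [MeasurableSpace (GA ((PlaneData.mixedRow q (a 0) (a 2)).withTransportedTorus g g' hgg' hg'g hgΩ))]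
    [BorelSpace (GA ((PlaneData.mixedRow q (a 0) (a 2)).withTransportedTorus g g' hgg' hg'g hgΩ))]
    (R : RTFData ((PlaneData.mixedRow q (a 0) (a 2)).withTransportedTorus g g' hgg' hg'g hgΩ))
    [R.μT.IsHaarMeasure] [R.μT'.IsHaarMeasure]
    (eP eM eP' eM' : InfinitePlace ↥(maximalRealSubfield E) → ℤ)
    (_he : eP (InfinitePlace.mk φ) - eM (InfinitePlace.mk φ) = 3 ∨ eP (InfinitePlace.mk φ) - eM (InfinitePlace.mk φ) = -3)
    (_he' : (0 < (φ lam).re → eP' (InfinitePlace.mk φ) - eM' (InfinitePlace.mk φ) =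
        eP (InfinitePlace.mk φ) - eM (InfinitePlace.mk φ)) ∧
      ((φ lam).re < 0 → eP' (InfinitePlace.mk φ) - eM' (InfinitePlace.mk φ) =
        -(eP (InfinitePlace.mk φ) - eM (InfinitePlace.mk φ))))
    (_hchi' : ∀ w : InfinitePlace ↥(maximalRealSubfield E),
      ChiMatchesAt' ((PlaneData.mixedRow q (a 0) (a 2)).withTransportedTorus g g' hgg' hg'g hgΩ) q w g g' (eP' w) (eM' w)
        R.chi')
    (μ : Measure (GA ((PlaneData.mixedRow q (a 0) (a 2)).withTransportedTorus g g' hgg' hg'g hgΩ))) [μ.IsHaarMeasure]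
    (DG : Set (GA ((PlaneData.mixedRow q (a 0) (a 2)).withTransportedTorus g g' hgg' hg'g hgΩ)))
    (fdG : IsFundamentalDomain (rationalPoints ((PlaneData.mixedRow q (a 0) (a 2)).withTransportedTorus g g' hgg' hg'g hgΩ))
      DG μ)
    (compG : IsCompact (closure DG)) (compT : IsCompact (closure R.DT)) (compT' : IsCompact (closure R.DT'))
    (hcm : ∀ w : InfinitePlace ↥(maximalRealSubfield E), IsCMAt q w)
    (γ₀ : GA ((PlaneData.mixedRow q (a 0) (a 2)).withTransportedTorus g g' hgg' hg'g hgΩ))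
    (νinf : Measure (torusInf ((PlaneData.mixedRow q (a 0) (a 2)).withTransportedTorus g g' hgg' hg'g hgΩ)))
    (νinf' : Measure (torusInf' ((PlaneData.mixedRow q (a 0) (a 2)).withTransportedTorus g g' hgg' hg'g hgΩ)))
    [νinf'.IsHaarMeasure]
    (μinf : Measure (infinitePart ((PlaneData.mixedRow q (a 0) (a 2)).withTransportedTorus g g' hgg' hg'g hgΩ)))
    [μinf.IsHaarMeasure]
    (hgrowth : ArchBallGrowth ((PlaneData.mixedRow q (a 0) (a 2)).withTransportedTorus g g' hgg' hg'g hgΩ) μinf)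
    (h : ∃ Rc : ℝ, 0 ≤ Rc ∧
      ((∫ t : torusInf ((PlaneData.mixedRow q (a 0) (a 2)).withTransportedTorus g g' hgg' hg'g hgΩ),
        R.chi t * archWitnessROf q a g g' hgg' hg'g hgΩ lam _hiso (InfinitePlace.mk φ) eP' eM' Rc
          (((t : torusT ((PlaneData.mixedRow q (a 0) (a 2)).withTransportedTorus g g' hgg' hg'g hgΩ)) :
            GA ((PlaneData.mixedRow q (a 0) (a 2)).withTransportedTorus g g' hgg' hg'g hgΩ))⁻¹ * γ₀) ∂νinf) ≠ 0) ∧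
      (∀ ffin : GA ((PlaneData.mixedRow q (a 0) (a 2)).withTransportedTorus g g' hgg' hg'g hgΩ) → ℂ,
      L1Class.IsFinFactor ((PlaneData.mixedRow q (a 0) (a 2)).withTransportedTorus g g' hgg' hg'g hgΩ) ffin →
      IsPseudoCoeffAt ((PlaneData.mixedRow q (a 0) (a 2)).withTransportedTorus g g' hgg' hg'g hgΩ)
        (Setting.ofAdelicData ((PlaneData.mixedRow q (a 0) (a 2)).withTransportedTorus g g' hgg' hg'g hgΩ) R μ DG fdG
          compG compT compT') q (InfinitePlace.mk φ) eP eM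
        (RTF.cj (L1Class.prodFn ((PlaneData.mixedRow q (a 0) (a 2)).withTransportedTorus g g' hgg' hg'g hgΩ)
          (archWitnessROf q a g g' hgg' hg'g hgΩ lam _hiso (InfinitePlace.mk φ) eP' eM' Rc) ffin))) ∧
      (∀ ffin : GA ((PlaneData.mixedRow q (a 0) (a 2)).withTransportedTorus g g' hgg' hg'g hgΩ) → ℂ,
      L1Class.IsFinFactor ((PlaneData.mixedRow q (a 0) (a 2)).withTransportedTorus g g' hgg' hg'g hgΩ) ffin →
      IsPseudoCoeffAt' ((PlaneData.mixedRow q (a 0) (a 2)).withTransportedTorus g g' hgg' hg'g hgΩ)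
        (Setting.ofAdelicData ((PlaneData.mixedRow q (a 0) (a 2)).withTransportedTorus g g' hgg' hg'g hgΩ) R μ DG fdG
          compG compT compT') q g g' (InfinitePlace.mk φ) eP' eM'
        (RTF.cj (L1Class.prodFn ((PlaneData.mixedRow q (a 0) (a 2)).withTransportedTorus g g' hgg' hg'g hgΩ)
          (archWitnessROf q a g g' hgg' hg'g hgΩ lam _hiso (InfinitePlace.mk φ) eP' eM' Rc) ffin)))) :
    L1Class.D3CoeffData' ((PlaneData.mixedRow q (a 0) (a 2)).withTransportedTorus g g' hgg' hg'g hgΩ)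
      (Setting.ofAdelicData ((PlaneData.mixedRow q (a 0) (a 2)).withTransportedTorus g g' hgg' hg'g hgΩ) R μ DG fdG
          compG compT compT') R q g g' (InfinitePlace.mk φ) eP eM eP' eM' γ₀ νinf νinf' := by
  obtain ⟨Rc, hRc, hF, hpseudo, hpseudo'⟩ := h
  exact d3CoeffData'_seesawR q a _ha φ _hpos g g' hgg' hg'g hgΩ lam _hlam _hiso R eP eM eP' eM' _he _he' _hchi' μ DG fdG
    compG compT compT' hcm γ₀ νinf νinf' μinf hgrowth Rc hRc hF hpseudo hpseudo'

end Seesaw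

end Summit.Ventures.HodgeRepro.Tier4.Line4

end
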